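import Summits.AtomisticToContinuum.Crystallization.Theorems.FrustratedLawDichotomyLinkCert

/-!
# FrustratedLawDichotomy · crux `AperiodicFrustratedLawGap` (stmt-AtomisticToContinuum-27623) — `G` ON THE SPHERE:
# `LinkCert θ ⟸ SphericalLinkCert θ`, a statement about twelve UNIT vectors and a 4-regular graph (decomp-a2c, prover hand 2, gen 11)

`LinkCert θ` (p821557) quantifies over twelve points of `ℝ³` with radial window `[1, 1+θ]` and the nd-coupled distance clauses — a
`33`-parameter family for the certification engine (critic row 472: coordinate branch-and-bound per contact graph, `9` thin + `1536` fat
graphs).  Lens-5's argument for `G` (NODE-g29 §3) is already an argument about ANGLES at the centre.  This file makes that official: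
projecting `p u ↦ p u / ‖p u‖` turns clauses 1–4 into three cosine windows,

* every pair: `⟪e u, e v⟫ ≤ 1 − (1+θ)⁻²/2` (from `‖p u − p v‖ ≥ max ‖·‖/(1+θ)`; angle `≥ 59.35°` at `θ = 1/100`),
* `B`-bonds: `1 − (1+θ)²/2 ≤ ⟪e u, e v⟫` (from `‖p u − p v‖ ≤ (1+θ)·min ‖·‖`; angle `≤ 60.66°`),
* `B`-non-bonds: `⟪e u, e v⟫ < (1+θ)/2` (from strictness `min ‖·‖ < ‖p u − p v‖`; angle `> 59.66°`),

so that `G` is certified on `(S²)¹²` — `21` parameters after the rotation gauge instead of `33`, uniformly for all `1545` graphs: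

* `SphericalLinkCert θ` — the finite statement on the sphere (same conclusion as `LinkCert θ`);
* ★ `linkCert_of_spherical : 0 ≤ θ → θ ≤ 1/2 → SphericalLinkCert θ → LinkCert θ`;
* by name: `kr2Shape_of_sphericalLinkCert`, `aperiodicFrustratedLawGap_of_sphericalLinkCert` (crux ⟸ Door ∧ CEG ∧ SphericalLinkCert(1/100)
  ∧ P ∧ M), `noFrustratedPeriodicMinimiser_of_sphericalLinkCert`.
The three cosine lemmas (`inner_le_of_dist_ge_max`, `le_inner_of_dist_le_min`, `inner_lt_of_min_lt_dist`) are stated for two vectors with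
norms in `[1, 1+θ]`.  `[folklore]`; one definition; no `sorry`; no `instance`/`notation`.
-/

noncomputable section

namespace Summit.AtomisticToContinuum.Crystallization.Theorems.FrustratedLawDichotomySphericalLinkCert

open Real RealInnerProductSpace
open Literature.Geometry.DiscreteGeometry
open Summit.AtomisticToContinuum.Crystallization.Theses.PricedLinkCensus (ChargedEnergyGap)
open Summit.AtomisticToContinuum.Crystallization.Theorems.FrustratedLawDichotomyTwoShellRigidityCut
  (E3 CapForcing KR2Shape kr2Shape_of_cut aperiodicFrustratedLawGap_of_cut noFrustratedPeriodicMinimiser_of_cut)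
open Summit.AtomisticToContinuum.Crystallization.Theorems.FrustratedLawDichotomyCappedRigidityCert (CappedCert)
open Summit.AtomisticToContinuum.Crystallization.Theorems.FrustratedLawDichotomyCappedRigidityCertPatterns (cappedRigidity_of_cert)
open Summit.AtomisticToContinuum.Crystallization.Theorems.FrustratedLawDichotomyLinkCert (LinkCert linkClassification_of_linkCert)

/-! ### §1 Three cosine windows for two near-unit vectors -/

/-- The polarisation identity in the form used here: `‖x − y‖² = ‖x‖² + ‖y‖² − 2⟪x, y⟫`. [folklore] -/
theorem norm_sub_sq_eq (x y : E3) : ‖x - y‖ ^ 2 = ‖x‖ ^ 2 + ‖y‖ ^ 2 - 2 * ⟪x, y⟫ := by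
  rw [norm_sub_sq_real]; ring

/-- For a nonzero `x`, `⟪x, y⟫ = ‖x‖ · ‖y‖ · ⟪x/‖x‖, y/‖y‖⟫`. [folklore] -/
theorem inner_eq_norm_mul_inner_unit {x y : E3} (hx : x ≠ 0) (hy : y ≠ 0) :
    ⟪x, y⟫ = ‖x‖ * ‖y‖ * ⟪‖x‖⁻¹ • x, ‖y‖⁻¹ • y⟫ := by
  rw [real_inner_smul_left, real_inner_smul_right]
  have hx' : ‖x‖ ≠ 0 := norm_ne_zero_iff.2 hx
  have hy' : ‖y‖ ≠ 0 := norm_ne_zero_iff.2 hy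
  field_simp

/-- **Every pair**: `‖x − y‖ ≥ max(‖x‖, ‖y‖)/(1+θ)` with `1 ≤ ‖x‖, ‖y‖ ≤ 1+θ`, `0 ≤ θ ≤ 1/2` gives
`⟪x/‖x‖, y/‖y‖⟫ ≤ 1 − (1+θ)⁻²/2`. [folklore] -/
theorem inner_unit_le_of_dist_ge {θ : ℝ} (hθ : 0 ≤ θ) (hθ1 : θ ≤ 1 / 2) {x y : E3}
    (hx1 : 1 ≤ ‖x‖) (hx2 : ‖x‖ ≤ 1 + θ) (hy1 : 1 ≤ ‖y‖) (hy2 : ‖y‖ ≤ 1 + θ)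
    (hdx : ‖x‖ ≤ (1 + θ) * ‖x - y‖) (hdy : ‖y‖ ≤ (1 + θ) * ‖x - y‖) :
    ⟪‖x‖⁻¹ • x, ‖y‖⁻¹ • y⟫ ≤ 1 - (1 + θ)⁻¹ ^ 2 / 2 := by
  have hxpos : 0 < ‖x‖ := by linarith
  have hypos : 0 < ‖y‖ := by linarith
  have hx0 : x ≠ 0 := norm_ne_zero_iff.1 hxpos.ne'
  have hy0 : y ≠ 0 := norm_ne_zero_iff.1 hypos.ne'
  have hlam : 0 < 1 + θ := by linarith
  set c : ℝ := ⟪‖x‖⁻¹ • x, ‖y‖⁻¹ • y⟫ with hc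
  have hin : ⟪x, y⟫ = ‖x‖ * ‖y‖ * c := inner_eq_norm_mul_inner_unit hx0 hy0
  have hsq := norm_sub_sq_eq x y
  set a := ‖x‖ with ha
  set b := ‖y‖ with hb
  set d := ‖x - y‖ with hd
  -- `d ≥ a/λ` and `d ≥ b/λ`; want `a² + b² − d² ≤ 2ab(1 − λ⁻²/2) = 2ab − ab·λ⁻²`
  set μ : ℝ := (1 + θ)⁻¹ with hμ
  have hμpos : 0 < μ := inv_pos.2 hlam
  have hμ1 : μ ≤ 1 := inv_le_one_of_one_le₀ (by linarith)
  have hμa : μ * a ≤ d := by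
    rw [hμ, inv_mul_le_iff₀ hlam]; exact hdx
  have hμb : μ * b ≤ d := by
    rw [hμ, inv_mul_le_iff₀ hlam]; exact hdy
  have hd0 : 0 ≤ d := norm_nonneg _
  -- `λ − 1/λ ≤ 1`, i.e. `(1+θ)μ ... `: we use `a, b ≤ 1+θ ≤ 3/2` and `μ ≥ 2/3`
  have hμ23 : 2 / 3 ≤ μ := by
    rw [hμ, le_inv_comm₀ (by norm_num) hlam]; linarith
  have hμsq : 4 / 9 ≤ μ ^ 2 := by nlinarith [hμ23]
  have key : a ^ 2 + b ^ 2 - d ^ 2 ≤ 2 * (a * b) * (1 - μ ^ 2 / 2) := by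
    -- wlog by symmetry both cases `a ≤ b` and `b ≤ a`
    rcases le_total a b with hab | hab
    · -- max = b: d² ≥ μ² b²; need a² + b² − μ²b² ≤ 2ab − abμ²  ⟺ (b − a)² ≤ μ² b (b − a) ⟸ b − a ≤ μ² b
      have hd2 : μ ^ 2 * b ^ 2 ≤ d ^ 2 := by
        have := mul_self_le_mul_self (by positivity) hμb
        nlinarith
      have h1 : b - a ≤ μ ^ 2 * b := by nlinarith [mul_le_mul_of_nonneg_right hμsq hypos.le]
      nlinarith [mul_nonneg (sub_nonneg.2 hab) (by linarith : (0:ℝ) ≤ μ ^ 2 * b - (b - a))]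
    · have hd2 : μ ^ 2 * a ^ 2 ≤ d ^ 2 := by
        have := mul_self_le_mul_self (by positivity) hμa
        nlinarith
      have h1 : a - b ≤ μ ^ 2 * a := by nlinarith [mul_le_mul_of_nonneg_right hμsq hxpos.le]
      nlinarith [mul_nonneg (sub_nonneg.2 hab) (by linarith : (0:ℝ) ≤ μ ^ 2 * a - (a - b))]
  have hab0 : 0 < a * b := mul_pos hxpos hypos
  have : 2 * (a * b) * c = a ^ 2 + b ^ 2 - d ^ 2 := by rw [hsq, hin]; ring
  have : 2 * (a * b) * c ≤ 2 * (a * b) * (1 - μ ^ 2 / 2) := by linarith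
  exact le_of_mul_le_mul_left this (by linarith)

/-- **Bonds**: `‖x − y‖ ≤ (1+θ)·min(‖x‖, ‖y‖)` with `1 ≤ ‖x‖, ‖y‖` gives `1 − (1+θ)²/2 ≤ ⟪x/‖x‖, y/‖y‖⟫`. [folklore] -/
theorem le_inner_unit_of_dist_le {θ : ℝ} {x y : E3} (hx1 : 1 ≤ ‖x‖) (hy1 : 1 ≤ ‖y‖)
    (hdx : ‖x - y‖ ≤ (1 + θ) * ‖x‖) (hdy : ‖x - y‖ ≤ (1 + θ) * ‖y‖) :
    1 - (1 + θ) ^ 2 / 2 ≤ ⟪‖x‖⁻¹ • x, ‖y‖⁻¹ • y⟫ := by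
  have hxpos : 0 < ‖x‖ := by linarith
  have hypos : 0 < ‖y‖ := by linarith
  have hx0 : x ≠ 0 := norm_ne_zero_iff.1 hxpos.ne'
  have hy0 : y ≠ 0 := norm_ne_zero_iff.1 hypos.ne'
  set c : ℝ := ⟪‖x‖⁻¹ • x, ‖y‖⁻¹ • y⟫ with hc
  have hin : ⟪x, y⟫ = ‖x‖ * ‖y‖ * c := inner_eq_norm_mul_inner_unit hx0 hy0
  have hsq := norm_sub_sq_eq x y
  set a := ‖x‖ with ha
  set b := ‖y‖ with hb
  set d := ‖x - y‖ with hd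
  have hd0 : 0 ≤ d := norm_nonneg _
  have key : 2 * (a * b) * (1 - (1 + θ) ^ 2 / 2) ≤ a ^ 2 + b ^ 2 - d ^ 2 := by
    rcases le_total a b with hab | hab
    · -- min = a: d ≤ λ a; a² + b² − λ²a² ≥ 2ab − λ²ab ⟺ (b − a)² ≥ λ² a (a − b), true since RHS ≤ 0
      have hd2 : d ^ 2 ≤ (1 + θ) ^ 2 * a ^ 2 := by
        have := mul_self_le_mul_self hd0 hdx
        nlinarith
      nlinarith [mul_nonneg (mul_nonneg (sq_nonneg (1 + θ)) hxpos.le) (sub_nonneg.2 hab), sq_nonneg (b - a)]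
    · have hd2 : d ^ 2 ≤ (1 + θ) ^ 2 * b ^ 2 := by
        have := mul_self_le_mul_self hd0 hdy
        nlinarith
      nlinarith [mul_nonneg (mul_nonneg (sq_nonneg (1 + θ)) hypos.le) (sub_nonneg.2 hab), sq_nonneg (a - b)]
  have hab0 : 0 < a * b := mul_pos hxpos hypos
  have : 2 * (a * b) * c = a ^ 2 + b ^ 2 - d ^ 2 := by rw [hsq, hin]; ring
  have : 2 * (a * b) * (1 - (1 + θ) ^ 2 / 2) ≤ 2 * (a * b) * c := by linarith
  exact le_of_mul_le_mul_left this (by linarith)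

/-- **Non-bonds**: `min(‖x‖, ‖y‖) < ‖x − y‖` with `1 ≤ ‖x‖, ‖y‖ ≤ 1+θ` gives `⟪x/‖x‖, y/‖y‖⟫ < (1+θ)/2`. [folklore] -/
theorem inner_unit_lt_of_min_lt_dist {θ : ℝ} {x y : E3} (hx1 : 1 ≤ ‖x‖) (hx2 : ‖x‖ ≤ 1 + θ) (hy1 : 1 ≤ ‖y‖)
    (hy2 : ‖y‖ ≤ 1 + θ) (hmin : min ‖x‖ ‖y‖ < ‖x - y‖) :
    ⟪‖x‖⁻¹ • x, ‖y‖⁻¹ • y⟫ < (1 + θ) / 2 := by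
  have hxpos : 0 < ‖x‖ := by linarith
  have hypos : 0 < ‖y‖ := by linarith
  have hx0 : x ≠ 0 := norm_ne_zero_iff.1 hxpos.ne'
  have hy0 : y ≠ 0 := norm_ne_zero_iff.1 hypos.ne'
  set c : ℝ := ⟪‖x‖⁻¹ • x, ‖y‖⁻¹ • y⟫ with hc
  have hin : ⟪x, y⟫ = ‖x‖ * ‖y‖ * c := inner_eq_norm_mul_inner_unit hx0 hy0
  have hsq := norm_sub_sq_eq x y
  set a := ‖x‖ with ha
  set b := ‖y‖ with hb
  set d := ‖x - y‖ with hd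
  have hd0 : 0 ≤ d := norm_nonneg _
  have key : a ^ 2 + b ^ 2 - d ^ 2 < 2 * (a * b) * ((1 + θ) / 2) := by
    rcases le_total a b with hab | hab
    · -- min = a < d: a² + b² − d² < b² ≤ ab(1+θ)
      rw [min_eq_left hab] at hmin
      have hd2 : a ^ 2 < d ^ 2 := by nlinarith
      nlinarith [mul_le_mul_of_nonneg_left hy2 hxpos.le, mul_le_mul_of_nonneg_right hab hypos.le]
    · rw [min_eq_right hab] at hmin
      have hd2 : b ^ 2 < d ^ 2 := by nlinarith
      nlinarith [mul_le_mul_of_nonneg_left hx2 hypos.le, mul_le_mul_of_nonneg_right hab hxpos.le]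
  have hab0 : 0 < a * b := mul_pos hxpos hypos
  have : 2 * (a * b) * c = a ^ 2 + b ^ 2 - d ^ 2 := by rw [hsq, hin]; ring
  have : 2 * (a * b) * c < 2 * (a * b) * ((1 + θ) / 2) := by linarith
  exact lt_of_mul_lt_mul_left this (by linarith)

/-! ### §2 The statement on the sphere and the reduction -/

/-- **`SphericalLinkCert θ` — `G` on the sphere.**  For twelve unit vectors `e : Fin 12 → ℝ³` and a 4-regular graph `B` on `Fin 12`: if
every pair has `⟪e u, e v⟫ ≤ 1 − (1+θ)⁻²/2`, every `B`-bond has `⟪e u, e v⟫ ≥ 1 − (1+θ)²/2`, and every `B`-non-bond has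
`⟪e u, e v⟫ < (1+θ)/2`, then `B` is the contact graph of the fcc or of the hcp kissing pattern via a bijection.
[certificate target; `(S²)¹²`, rotation gauge ⇒ 21 parameters] -/
def SphericalLinkCert (θ : ℝ) : Prop :=
  ∀ (e : Fin 12 → E3) (B : SimpleGraph (Fin 12)),
    (∀ u, ‖e u‖ = 1) →
    (∀ u v, u ≠ v → ⟪e u, e v⟫ ≤ 1 - (1 + θ)⁻¹ ^ 2 / 2) →
    (∀ u v, B.Adj u v → 1 - (1 + θ) ^ 2 / 2 ≤ ⟪e u, e v⟫) →
    (∀ u v, u ≠ v → ¬ B.Adj u v → ⟪e u, e v⟫ < (1 + θ) / 2) →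
    (∀ u, ({v | B.Adj u v} : Set (Fin 12)).ncard = 4) →
      (∃ τ₀ : ↥fccKissingPattern → Fin 12, Function.Bijective τ₀ ∧
          ∀ u v : ↥fccKissingPattern, B.Adj (τ₀ u) (τ₀ v) ↔ dist (u : E3) (v : E3) = 1) ∨
        (∃ τ₀ : ↥hcpKissingPattern → Fin 12, Function.Bijective τ₀ ∧
          ∀ u v : ↥hcpKissingPattern, B.Adj (τ₀ u) (τ₀ v) ↔ dist (u : E3) (v : E3) = 1)

/-- ★ **THE REDUCTION `SphericalLinkCert θ → LinkCert θ`** (`0 ≤ θ ≤ 1/2`): project the twelve points to the unit sphere and read the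
three cosine windows off the nd-coupled clauses. [folklore] -/
theorem linkCert_of_spherical {θ : ℝ} (hθ : 0 ≤ θ) (hθ1 : θ ≤ 1 / 2) (hS : SphericalLinkCert θ) : LinkCert θ := by
  intro p B hrad hinj hnd hbond hnon hreg
  have hpos : ∀ u, 0 < ‖p u‖ := fun u => lt_of_lt_of_le one_pos (hrad u).1
  have hp0 : ∀ u, p u ≠ 0 := fun u => norm_ne_zero_iff.1 (hpos u).ne'
  set e : Fin 12 → E3 := fun u => ‖p u‖⁻¹ • p u with he
  have hunit : ∀ u, ‖e u‖ = 1 := by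
    intro u
    simp only [he]
    rw [norm_smul, norm_inv, norm_norm, inv_mul_cancel₀ (hpos u).ne']
  have hmem : ∀ v, p v ∈ insert (0 : E3) (Set.range p) := fun v => Or.inr ⟨v, rfl⟩
  have hne : ∀ {u v}, u ≠ v → p v ≠ p u := fun huv h => huv (hinj h).symm
  refine hS e B hunit ?_ ?_ ?_ hreg
  · intro u v huv
    have h1 : ‖p u‖ ≤ (1 + θ) * ‖p u - p v‖ := hnd u (p v) (hmem v) (hne huv)
    have h2 : ‖p v‖ ≤ (1 + θ) * ‖p u - p v‖ := by
      rw [norm_sub_rev]; exact hnd v (p u) (hmem u) (hne (Ne.symm huv))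
    exact inner_unit_le_of_dist_ge hθ hθ1 (hrad u).1 (hrad u).2 (hrad v).1 (hrad v).2 h1 h2
  · intro u v huv
    have hne' : u ≠ v := huv.ne
    have h1 : ‖p u - p v‖ ≤ (1 + θ) * ‖p u‖ := by
      have := hbond u v huv 0 (Or.inl rfl) (Ne.symm (hp0 u))
      rwa [sub_zero] at this
    have h2 : ‖p u - p v‖ ≤ (1 + θ) * ‖p v‖ := by
      have := hbond v u huv.symm 0 (Or.inl rfl) (Ne.symm (hp0 v))
      rwa [sub_zero, norm_sub_rev] at this
    exact le_inner_unit_of_dist_le (hrad u).1 (hrad v).1 h1 h2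
  · intro u v huv hnadj
    exact inner_unit_lt_of_min_lt_dist (hrad u).1 (hrad u).2 (hrad v).1 (hrad v).2 (hnon u v huv hnadj)

/-! ### §3 The column by name -/

/-- **`KR2Shape` from `SphericalLinkCert(1/100)` (G on the sphere), `CapForcing(1/100)` (P) and `CappedCert(1/100,1/20)` ×2 (M).** [folklore] -/
theorem kr2Shape_of_sphericalLinkCert (hG : SphericalLinkCert (1 / 100)) (hP : CapForcing (1 / 100))
    (hf : CappedCert (1 / 100) (1 / 20) fccKissingPattern) (hh : CappedCert (1 / 100) (1 / 20) hcpKissingPattern) : KR2Shape :=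
  kr2Shape_of_cut (linkClassification_of_linkCert (linkCert_of_spherical (by norm_num) (by norm_num) hG)) hP
    (cappedRigidity_of_cert hf hh)

/-- **`AperiodicFrustratedLawGap` (crux of item 27623) BY NAME** from `MuEquilibriumDoor ∧ ChargedEnergyGap ∧ SphericalLinkCert(1/100) ∧
CapForcing(1/100) ∧ CappedCert fcc ∧ CappedCert hcp`. [folklore] -/
theorem aperiodicFrustratedLawGap_of_sphericalLinkCert
    (hDoor : Summit.AtomisticToContinuum.Crystallization.Theses.GrainCoreNetworkSplit.MuEquilibriumDoor) (hgap : ChargedEnergyGap)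
    (hG : SphericalLinkCert (1 / 100)) (hP : CapForcing (1 / 100))
    (hf : CappedCert (1 / 100) (1 / 20) fccKissingPattern) (hh : CappedCert (1 / 100) (1 / 20) hcpKissingPattern) :
    Summit.AtomisticToContinuum.Crystallization.Theses.FrustratedLawDichotomy.AperiodicFrustratedLawGap :=
  aperiodicFrustratedLawGap_of_cut hDoor hgap (linkClassification_of_linkCert (linkCert_of_spherical (by norm_num) (by norm_num) hG)) hP
    (cappedRigidity_of_cert hf hh)

/-- **Item 26654 `NoFrustratedPeriodicMinimiser`, door-free**, from `ChargedEnergyGap ∧ SphericalLinkCert(1/100) ∧ CapForcing(1/100) ∧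
CappedCert ×2`. [folklore] -/
theorem noFrustratedPeriodicMinimiser_of_sphericalLinkCert (hgap : ChargedEnergyGap)
    (hG : SphericalLinkCert (1 / 100)) (hP : CapForcing (1 / 100))
    (hf : CappedCert (1 / 100) (1 / 20) fccKissingPattern) (hh : CappedCert (1 / 100) (1 / 20) hcpKissingPattern) :
    Summit.AtomisticToContinuum.Crystallization.Theses.PeriodicChargeSplit.NoFrustratedPeriodicMinimiser :=
  noFrustratedPeriodicMinimiser_of_cut hgap (linkClassification_of_linkCert (linkCert_of_spherical (by norm_num) (by norm_num) hG)) hP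
    (cappedRigidity_of_cert hf hh)

end Summit.AtomisticToContinuum.Crystallization.Theorems.FrustratedLawDichotomySphericalLinkCert

end
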